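import Summits.CriticalPhenomena.PercolationContinuityZ3.Theorems.PercNearOneGluingNoHeavyConstsConditionedMarker
import Summits.CriticalPhenomena.PercolationContinuityZ3.Theorems.PercNearOneGluingNoHeavyConstsMDLXJointMarkerLattice
import HarnessLib

/-!
# MDL(X)′ for every functional pinned to the event `{s ↔ z}`: the link constant never exceeds `P(s ↮ z | s ↮ y, s ↮ X)`
# (PAPER-2 track (ii): constants of the CSH family; seat `prim-consts-2`, gen 17)

builds on p205010 (kernel theorem, internal audit signed; external expert review pending).  Support file (`--supports
stmt-CriticalPhenomena-4575`); memo `run/shared/lean/prim/consts/FROM-prim-consts-2-g17-CYLINDER-DUALITY.md` §2.  No definitions, no named facts,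
no sorries; standard axioms.

Notation (as in `…ConstsMDLXJoint.lean`): owner `s`, avoided set `X`, markers `y`, `z`; `D = {s ↮ X}`, `𝒜 = {y ↮ {s}∪X}`, `T = 𝒜 ∩ D`,
`W = {y ↔ z}`, `Y = {s ↔ y}`, `N = Yᶜ`, `Z = {s ↔ z}`, `Q = {y ↔ X}` (the avoided cluster swallows `y`; `D ∩ Q ⊆ N`), `ν = μ(·|D)`,
`p' = μ(T∩W)/μ(T)`.  `Consts.MDLXJoint` at a monotone functional `F` of the open edge cluster `C_s` reads
`μ(T∩W)·[μ(D)∫_{D∩Y}F − (∫_D F)μ(D∩Y)] ≤ μ(T)·[μ(D)∫_{D∩Z}F − (∫_D F)μ(D∩Z)]`.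

* KEY INEQUALITY (already in the tree as `Consts.mdlx_marker_notReach_le`, gen 9, the `1{s↔y ∧ s↔z}` corner of the marker lattice):
  `μ(T∩W)·μ(D∩N) ≤ μ(T)·μ(D∩Zᶜ)`, i.e. `p'·ν(s ↮ y) ≤ ν(s ↮ z)` (BHK Thm 1.3 with vertex sets for the source `X ∪ {y}` repelled from `{s}`:
  `ν(W | y↔X) ≥ ν(W | s↮y) ≥ ν(W | T)`, and `W ⊆ Zᶜ` on both `T` and `D ∩ {y↔X}`).
* `Consts.mdlxJoint_of_eq_off_reach` — **THEOREM: the `Consts.MDLXJoint` inequality holds, in every finite weighted graph, at every monotone `F`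
  that is constant off `{z ∈ V(C_s)}`** (`F(C) = F(∅)` whenever no pair of `C` contains `z`; e.g. `1{s↔z}·G` for any monotone `G ≥ 0`, every
  cylinder `1{C₀ ⊆ C_s}` whose pattern `C₀` reaches `z`, the pair functional `1{s(s,z) ∈ C_s}`).  Proof: after subtracting `F(∅)` one has `F ≥ 0`
  and `∫_{D∩Z}F = ∫_D F =: I`, so the right bracket is `I·μ(D∩Zᶜ)` and the left one is `≤ I·μ(D∩N)`; the key inequality finishes.  This
  extends the marker-lattice theorem `Consts.mdlxJoint_of_markerMeasurable` (functionals of `(1{s↔y}, 1{s↔z})` only) to the infinite class of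
  functionals supported on `{s↔z}`, and is the mirror image of the class `{U ⊇ Y}` ⊂ `{C0 ≤ 0}` of `Consts.mdlxJoint_of_lowerMarker_le` (gen 16):
  there the up-event contains the marker event, here it is contained in the target event.  Since the MDL(X)′ margin is linear in `F`, the proved functionals form a convex cone (sums of members of
  the proved classes are proved).
* `Consts.mdlxJoint_reachMul` — the instance `F = 1{s↔z}·G`, `G ≥ 0` monotone, `s ≠ z`.
* `Consts.mdlxJoint_markerPairZ` — the instance `F = 1{s(s,z) ∈ ·}` (the single-pair cylinder at the target marker; companion of
  `Consts.mdlxJoint_markerPair`, the cylinder at the pair `s(s,y)`, file `…ConstsMDLXJointMarkerPair.lean`).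
[cite: VandenbergHaggstromKahn2005, Thm. 1.3 (p. 6) with Remark 1 after Thm. 1.2 (p. 5)]
-/

noncomputable section

namespace Summit.CriticalPhenomena.PercolationContinuityZ3.Theorems

open MeasureTheory Set Literature.Probability.LatticeModels Literature.Probability.Percolation
open scoped Classical

namespace Consts

variable {V : Type*} [Fintype V]

/-- **MDL(X)′ AT EVERY FUNCTIONAL PINNED TO `{s ↔ z}`.**  For all weights, owner `s`, avoided set `X`, markers `y`, `z`, and every monotone
functional `F` of the open edge cluster of `s` with `F(C) = F(∅)` whenever no pair of `C` contains `z` (so that `F(C_s)` is constant off `{s↔z}`),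
the `Consts.MDLXJoint` inequality holds:
`μ(T∩W)·[μ(D)∫_{D∩Y}F(C_s) − (∫_D F(C_s))μ(D∩Y)] ≤ μ(T)·[μ(D)∫_{D∩Z}F(C_s) − (∫_D F(C_s))μ(D∩Z)]`.
[cite: VandenbergHaggstromKahn2005, Thm. 1.3 (p. 6) with Remark 1 after Thm. 1.2 (p. 5)] -/
theorem mdlxJoint_of_eq_off_reach (w : Sym2 V → unitInterval) (s y z : V) (X : Set V)
    (F : Set (Sym2 V) → ℝ) (hF : Monotone F) (hFz : ∀ C : Set (Sym2 V), (∀ e ∈ C, z ∉ e) → F C = F ∅) :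
    (prodBernoulli w).real ({ω : BondConfig V | ∀ x ∈ insert s X, ¬ (openGraph ω).Reachable y x} ∩
          {ω | ∀ x ∈ X, ¬ (openGraph ω).Reachable s x} ∩ openConn y z) *
        ((prodBernoulli w).real {ω : BondConfig V | ∀ x ∈ X, ¬ (openGraph ω).Reachable s x} *
            (∫ ω in {ω : BondConfig V | ∀ x ∈ X, ¬ (openGraph ω).Reachable s x} ∩ openConn s y,
              F (openEdgeCluster ω s) ∂(prodBernoulli w)) -
          (∫ ω in {ω : BondConfig V | ∀ x ∈ X, ¬ (openGraph ω).Reachable s x},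
              F (openEdgeCluster ω s) ∂(prodBernoulli w)) *
            (prodBernoulli w).real ({ω : BondConfig V | ∀ x ∈ X, ¬ (openGraph ω).Reachable s x} ∩ openConn s y)) ≤
      (prodBernoulli w).real ({ω : BondConfig V | ∀ x ∈ insert s X, ¬ (openGraph ω).Reachable y x} ∩
          {ω | ∀ x ∈ X, ¬ (openGraph ω).Reachable s x}) *
        ((prodBernoulli w).real {ω : BondConfig V | ∀ x ∈ X, ¬ (openGraph ω).Reachable s x} *
            (∫ ω in {ω : BondConfig V | ∀ x ∈ X, ¬ (openGraph ω).Reachable s x} ∩ openConn s z,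
              F (openEdgeCluster ω s) ∂(prodBernoulli w)) -
          (∫ ω in {ω : BondConfig V | ∀ x ∈ X, ¬ (openGraph ω).Reachable s x},
              F (openEdgeCluster ω s) ∂(prodBernoulli w)) *
            (prodBernoulli w).real ({ω : BondConfig V | ∀ x ∈ X, ¬ (openGraph ω).Reachable s x} ∩ openConn s z)) := by
  classical
  set μ := prodBernoulli w with hμ
  have hmeas : ∀ S : Set (BondConfig V), MeasurableSet S := fun _ => MeasurableSet.of_discrete
  set D : Set (BondConfig V) := {ω | ∀ x ∈ X, ¬ (openGraph ω).Reachable s x} with hD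
  set TW : Set (BondConfig V) := {ω : BondConfig V | ∀ x ∈ insert s X, ¬ (openGraph ω).Reachable y x} ∩ D ∩ openConn y z
    with hTW
  set T : Set (BondConfig V) := {ω : BondConfig V | ∀ x ∈ insert s X, ¬ (openGraph ω).Reachable y x} ∩ D with hT
  set Yv : Set (BondConfig V) := openConn s y with hYv
  set Zv : Set (BondConfig V) := openConn s z with hZv
  set c : ℝ := F ∅ with hc
  set f : BondConfig V → ℝ := fun ω => F (openEdgeCluster ω s) with hf
  set g : BondConfig V → ℝ := fun ω => f ω - c with hg
  have hg0 : ∀ ω, 0 ≤ g ω := fun ω => sub_nonneg.2 (hF (empty_subset _))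
  have hgZ : ∀ ω, ω ∉ Zv → g ω = 0 := by
    intro ω hω
    have hno : ∀ e ∈ openEdgeCluster ω s, z ∉ e := by
      intro e he hze
      exact hω ((reachable_iff_exists_mem_openEdgeCluster ω s z).2 (Or.inr ⟨e, he, hze⟩))
    show F (openEdgeCluster ω s) - F ∅ = 0
    rw [hFz _ hno, sub_self]
  -- integrals of `f` versus `g`
  have hfg : ∀ S : Set (BondConfig V), ∫ ω in S, f ω ∂μ = (∫ ω in S, g ω ∂μ) + c * μ.real S := by
    intro S
    have : (fun ω => f ω) = fun ω => g ω + c := by funext ω; simp [hg]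
    rw [this, integral_add Integrable.of_finite Integrable.of_finite, setIntegral_const, smul_eq_mul, mul_comm]
  set I := ∫ ω in D, g ω ∂μ with hI
  have hI0 : 0 ≤ I := setIntegral_nonneg (hmeas D) fun ω _ => hg0 ω
  -- `∫_{D ∩ Y} g ≤ I` and `∫_{D ∩ Z} g = I`
  have hIY : ∫ ω in D ∩ Yv, g ω ∂μ ≤ I := by
    have h := setIntegral_inter_add_compl w D Yv g
    have h2 : 0 ≤ ∫ ω in D ∩ Yvᶜ, g ω ∂μ := setIntegral_nonneg (hmeas _) fun ω _ => hg0 ω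
    linarith
  have hIZ : ∫ ω in D ∩ Zv, g ω ∂μ = I := by
    have h := setIntegral_inter_add_compl w D Zv g
    have h2 : ∫ ω in D ∩ Zvᶜ, g ω ∂μ = 0 :=
      setIntegral_eq_zero_of_forall_eq_zero fun ω hω => hgZ ω hω.2
    linarith
  -- the brackets are shift invariant
  have hbY : μ.real D * (∫ ω in D ∩ Yv, f ω ∂μ) - (∫ ω in D, f ω ∂μ) * μ.real (D ∩ Yv) =
      μ.real D * (∫ ω in D ∩ Yv, g ω ∂μ) - I * μ.real (D ∩ Yv) := by
    rw [hfg (D ∩ Yv), hfg D]; ring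
  have hbZ : μ.real D * (∫ ω in D ∩ Zv, f ω ∂μ) - (∫ ω in D, f ω ∂μ) * μ.real (D ∩ Zv) =
      I * μ.real (D ∩ Zvᶜ) := by
    rw [hfg (D ∩ Zv), hfg D, hIZ]
    have hsplit : μ.real (D ∩ Zv) + μ.real (D ∩ Zvᶜ) = μ.real D := by
      have h := measureReal_inter_add_sdiff (μ := μ) (s := D) (hmeas Zv)
      rwa [Set.sdiff_eq] at h
    rw [← hsplit]; ring
  have hsplitY : μ.real (D ∩ Yv) + μ.real (D ∩ Yvᶜ) = μ.real D := by
    have h := measureReal_inter_add_sdiff (μ := μ) (s := D) (hmeas Yv)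
    rwa [Set.sdiff_eq] at h
  change μ.real TW * (μ.real D * (∫ ω in D ∩ Yv, f ω ∂μ) - (∫ ω in D, f ω ∂μ) * μ.real (D ∩ Yv)) ≤
    μ.real T * (μ.real D * (∫ ω in D ∩ Zv, f ω ∂μ) - (∫ ω in D, f ω ∂μ) * μ.real (D ∩ Zv))
  rw [hbY, hbZ]
  -- left bracket ≤ I · μ(D ∩ N)
  have hleft : μ.real D * (∫ ω in D ∩ Yv, g ω ∂μ) - I * μ.real (D ∩ Yv) ≤ I * μ.real (D ∩ Yvᶜ) := by
    rw [← hsplitY]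
    nlinarith [hIY, measureReal_nonneg (μ := μ) (s := D)]
  have key := mdlx_marker_notReach_le w s y z X
  change μ.real TW * μ.real (D ∩ Yvᶜ) ≤ μ.real T * μ.real (D ∩ Zvᶜ) at key
  have hTW0 : 0 ≤ μ.real TW := measureReal_nonneg
  calc μ.real TW * (μ.real D * (∫ ω in D ∩ Yv, g ω ∂μ) - I * μ.real (D ∩ Yv))
      ≤ μ.real TW * (I * μ.real (D ∩ Yvᶜ)) := mul_le_mul_of_nonneg_left hleft hTW0
    _ = I * (μ.real TW * μ.real (D ∩ Yvᶜ)) := by ring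
    _ ≤ I * (μ.real T * μ.real (D ∩ Zvᶜ)) := mul_le_mul_of_nonneg_left key hI0
    _ = μ.real T * (I * μ.real (D ∩ Zvᶜ)) := by ring

/-- **Instance: `F = 1{s ↔ z} · G`** for a monotone `G ≥ 0` (`s ≠ z`): the `Consts.MDLXJoint` inequality holds at
`C ↦ connIndicatorFn s z C · G C`. [cite: VandenbergHaggstromKahn2005, Thm. 1.3 (p. 6)] -/
theorem mdlxJoint_reachMul (w : Sym2 V → unitInterval) (s y z : V) (X : Set V) (hsz : s ≠ z)
    (G : Set (Sym2 V) → ℝ) (hG : Monotone G) (hG0 : ∀ C, 0 ≤ G C) :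
    (prodBernoulli w).real ({ω : BondConfig V | ∀ x ∈ insert s X, ¬ (openGraph ω).Reachable y x} ∩
          {ω | ∀ x ∈ X, ¬ (openGraph ω).Reachable s x} ∩ openConn y z) *
        ((prodBernoulli w).real {ω : BondConfig V | ∀ x ∈ X, ¬ (openGraph ω).Reachable s x} *
            (∫ ω in {ω : BondConfig V | ∀ x ∈ X, ¬ (openGraph ω).Reachable s x} ∩ openConn s y,
              connIndicatorFn s z (openEdgeCluster ω s) * G (openEdgeCluster ω s) ∂(prodBernoulli w)) -
          (∫ ω in {ω : BondConfig V | ∀ x ∈ X, ¬ (openGraph ω).Reachable s x},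
              connIndicatorFn s z (openEdgeCluster ω s) * G (openEdgeCluster ω s) ∂(prodBernoulli w)) *
            (prodBernoulli w).real ({ω : BondConfig V | ∀ x ∈ X, ¬ (openGraph ω).Reachable s x} ∩ openConn s y)) ≤
      (prodBernoulli w).real ({ω : BondConfig V | ∀ x ∈ insert s X, ¬ (openGraph ω).Reachable y x} ∩
          {ω | ∀ x ∈ X, ¬ (openGraph ω).Reachable s x}) *
        ((prodBernoulli w).real {ω : BondConfig V | ∀ x ∈ X, ¬ (openGraph ω).Reachable s x} *
            (∫ ω in {ω : BondConfig V | ∀ x ∈ X, ¬ (openGraph ω).Reachable s x} ∩ openConn s z,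
              connIndicatorFn s z (openEdgeCluster ω s) * G (openEdgeCluster ω s) ∂(prodBernoulli w)) -
          (∫ ω in {ω : BondConfig V | ∀ x ∈ X, ¬ (openGraph ω).Reachable s x},
              connIndicatorFn s z (openEdgeCluster ω s) * G (openEdgeCluster ω s) ∂(prodBernoulli w)) *
            (prodBernoulli w).real ({ω : BondConfig V | ∀ x ∈ X, ¬ (openGraph ω).Reachable s x} ∩ openConn s z)) := by
  classical
  have hmono : Monotone (fun C : Set (Sym2 V) => connIndicatorFn s z C * G C) := by
    intro C C' hCC'
    have h1 := monotone_connIndicatorFn s z hCC'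
    have hc0 : 0 ≤ connIndicatorFn s z C := by unfold connIndicatorFn; split_ifs <;> norm_num
    exact mul_le_mul h1 (hG hCC') (hG0 C) (hc0.trans h1)
  have hvan : ∀ C : Set (Sym2 V), (∀ e ∈ C, z ∉ e) → connIndicatorFn s z C * G C = connIndicatorFn s z ∅ * G ∅ := by
    intro C hC
    have h1 : connIndicatorFn s z C = 0 := by
      unfold connIndicatorFn
      rw [if_neg]
      rintro (h | ⟨e, he, hze⟩)
      · exact hsz h.symm
      · exact hC e he hze
    have h2 : connIndicatorFn s z (∅ : Set (Sym2 V)) = 0 := by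
      unfold connIndicatorFn
      rw [if_neg]
      rintro (h | ⟨e, he, -⟩)
      · exact hsz h.symm
      · exact he
    rw [h1, h2, zero_mul, zero_mul]
  exact mdlxJoint_of_eq_off_reach w s y z X _ hmono hvan

/-- **Instance: the single-pair cylinder at the target marker, `F = 1{s(s,z) ∈ ·}`** — the `Consts.MDLXJoint` inequality holds at it in every
weighted graph (companion of `Consts.mdlxJoint_markerPair` for the pair `s(s,y)`). [cite: VandenbergHaggstromKahn2005, Thm. 1.3 (p. 6)] -/
theorem mdlxJoint_markerPairZ (w : Sym2 V → unitInterval) (s y z : V) (X : Set V) :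
    (prodBernoulli w).real ({ω : BondConfig V | ∀ x ∈ insert s X, ¬ (openGraph ω).Reachable y x} ∩
          {ω | ∀ x ∈ X, ¬ (openGraph ω).Reachable s x} ∩ openConn y z) *
        ((prodBernoulli w).real {ω : BondConfig V | ∀ x ∈ X, ¬ (openGraph ω).Reachable s x} *
            (∫ ω in {ω : BondConfig V | ∀ x ∈ X, ¬ (openGraph ω).Reachable s x} ∩ openConn s y,
              (fun C : Set (Sym2 V) => if s(s, z) ∈ C then (1 : ℝ) else 0) (openEdgeCluster ω s) ∂(prodBernoulli w)) -
          (∫ ω in {ω : BondConfig V | ∀ x ∈ X, ¬ (openGraph ω).Reachable s x},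
              (fun C : Set (Sym2 V) => if s(s, z) ∈ C then (1 : ℝ) else 0) (openEdgeCluster ω s) ∂(prodBernoulli w)) *
            (prodBernoulli w).real ({ω : BondConfig V | ∀ x ∈ X, ¬ (openGraph ω).Reachable s x} ∩ openConn s y)) ≤
      (prodBernoulli w).real ({ω : BondConfig V | ∀ x ∈ insert s X, ¬ (openGraph ω).Reachable y x} ∩
          {ω | ∀ x ∈ X, ¬ (openGraph ω).Reachable s x}) *
        ((prodBernoulli w).real {ω : BondConfig V | ∀ x ∈ X, ¬ (openGraph ω).Reachable s x} *
            (∫ ω in {ω : BondConfig V | ∀ x ∈ X, ¬ (openGraph ω).Reachable s x} ∩ openConn s z,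
              (fun C : Set (Sym2 V) => if s(s, z) ∈ C then (1 : ℝ) else 0) (openEdgeCluster ω s) ∂(prodBernoulli w)) -
          (∫ ω in {ω : BondConfig V | ∀ x ∈ X, ¬ (openGraph ω).Reachable s x},
              (fun C : Set (Sym2 V) => if s(s, z) ∈ C then (1 : ℝ) else 0) (openEdgeCluster ω s) ∂(prodBernoulli w)) *
            (prodBernoulli w).real ({ω : BondConfig V | ∀ x ∈ X, ¬ (openGraph ω).Reachable s x} ∩ openConn s z)) := by
  classical
  have hmono : Monotone (fun C : Set (Sym2 V) => if s(s, z) ∈ C then (1 : ℝ) else 0) := by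
    intro C C' hCC'
    by_cases h : s(s, z) ∈ C
    · simp only [if_pos h, if_pos (hCC' h), le_refl]
    · simp only [if_neg h]; split_ifs <;> norm_num
  have hvan : ∀ C : Set (Sym2 V), (∀ e ∈ C, z ∉ e) →
      (fun C : Set (Sym2 V) => if s(s, z) ∈ C then (1 : ℝ) else 0) C =
        (fun C : Set (Sym2 V) => if s(s, z) ∈ C then (1 : ℝ) else 0) ∅ := by
    intro C hC
    have h1 : s(s, z) ∉ C := fun h => hC _ h (Sym2.mem_mk_right s z)
    simp only [if_neg h1, mem_empty_iff_false, if_false]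
  exact mdlxJoint_of_eq_off_reach w s y z X _ hmono hvan

end Consts

end Summit.CriticalPhenomena.PercolationContinuityZ3.Theorems

end
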